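import Summits.BirchSwinnertonDyer.BirchSwinnertonDyer.Theorems.GenusKolyvaginAtTwoK4NegFrameRigidityTwoFrameLedger
import Summits.BirchSwinnertonDyer.BirchSwinnertonDyer.Theorems.GenusKolyvaginAtTwoK4PosFrameRigidityTwoFrameLedger
import Summits.BirchSwinnertonDyer.BirchSwinnertonDyer.Theorems.GenusKolyvaginAtTwoShaRatCardOfKFour
import Summits.BirchSwinnertonDyer.BirchSwinnertonDyer.Theorems.GenusKolyvaginAtTwoGenusDeepSupplyAtTwoNegDiscNarrowKFourCellLeafCurrency
import Summits.BirchSwinnertonDyer.BirchSwinnertonDyer.Theorems.GenusKolyvaginAtTwoGenusPrimitiveSupplyAtTwoPosDiscShallowKFourPosLeafCurrency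
import HarnessLib

/-!
# Route `GenusKolyvaginAtTwo`, cruxes K₄⁻ `K4Neg` (stmt-BirchSwinnertonDyer-31526) / K₄⁺ `K4Pos` (stmt-BirchSwinnertonDyer-31469):
# A K₄ WITNESS IS THE CANCELLATION OF THE TWO BSD₂-DEFECTS, AND «TWO OUT OF THREE» AMONG {BSD₂(E), BSD₂(E^(d_K)), K₄-witness} ON THE CUT

LEAD seat `bsd-line-gk2-p1` g26 (cell `bsd-f1-sign2`), route `GenusKolyvaginAtTwo` rev 59; sequel of `…HeegnerValuationLedger` (p781087) and the
two-frame ledgers (p782124/p782125).  THEOREMS ONLY (no definition, no named fact, no `sorry`); standard axioms.  **BSD is NOT proved by this file;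
K4Neg / K4Pos are NOT proved; no item is closed.**  CONDITIONAL on the route item Q2 `KolyvaginRelationAtTwo` (24880) and on the route's four PRINT
items (`GrossZagierAllLevels`, `MultPublishedInputsAtTwo`, `EntireLFunctionRat`, `MilneAnyModel`), all displayed as binders.

WHAT.  The LEAD table (g24) read the K₄ kernels on the cut as «K4 at `E` ⟺ `#Ш(E/ℚ)[2^∞] = 4^(M₀)`» (★★: p773559 §4 / gk2-p4 §3) and, GIVEN
`BSD₂(Wd)`, as «K4 at `E` ⟺ `BSD₂(E)`» (`LeafCurrency.kFourNeg_conclusion_iff_bsdp`, `PlusDescent.kFourPos_conclusion_iff_bsdp`).  The one-frame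
valuation ledger of this seat (`ValuationLedger.k4Neg_frameLedger_eq` / `k4Pos_frameLedger_eq`: `2·M₀ = ord₂ #Ш_an(E) + ord₂ #Ш_an(Wd)` on the K₄ cells,
mod PRINT, no cut) turns ★★ into a statement about the two BSD₂-DEFECTS `δ(X) := ord₂ #Ш_an(X) − ord₂ #Ш(X/ℚ)[2^∞]`:

* §1 `exists_rat_shaAn_twin` — on any supply frame, `#Ш_an(Wd)` is rational as soon as `#Ш_an(E)` is (Milne's identity read for the twin).
* §2 `kFourNeg_witness_iff_defects_cancel` / `kFourPos_witness_iff_defects_cancel` — on the K₄ cut cells, mod Q2 + PRINT: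
  **K4-witness at the frame ⟺ `ord₂ #Ш(E/ℚ)[2^∞] = ord₂ #Ш_an(E) + ord₂ #Ш_an(Wd)`** (⟺ `δ(E) + δ(Wd) = 0`, as `Ш(Wd)[2^∞] = 0`).
* §3 `bsdp_twin_of_kFourNeg_witness_of_bsdp` / `…kFourPos…` — THE NEW LEG: **`BSD₂(E)` ∧ K4-witness ⟹ `BSD₂(Wd)`**; with the LEAD/gk2-p5 leaf
  currency (`BSD₂(Wd)` ∧ K4-witness ⟹ `BSD₂(E)`) and Lossless §2 (`BSD₂(E)` ∧ `BSD₂(Wd)` ⟹ K4-witness) this is **«TWO OUT OF THREE»** among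
  {`BSD₂(E)`, `BSD₂(E^(d_K))`, K4-witness at the frame} on the cut; §4 `kFourNeg_witness_iff_bsdp_twin_of_bsdp` / `…kFourPos…`: GIVEN `BSD₂(E)`
  (WALL row 1 at `E`), **K4 at the frame ⟺ `BSD₂(E^(d_K))`** — the K₄ supply crux IS the route item U₂ `MinimalTwinBSDTwo` restricted to the cell's
  own twins, once the rank-zero wall is granted (the pen's LINES 33/34 read the converse: WALL + U₂ ⟹ K4|cut).
READING (census, not progress): on the cut the three open inputs {WALL row 1 on the cell, U₂ on the cell's twins, K₄} are pairwise equivalent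
modulo the third, Q2 and PRINT; none is decided here.

References: [GrossZagier1986] V §2 (2.2); [Milne1972ArithmeticAV] §1 Thm. 1; [McCallumLMS1991] §5 Thm. 5.4; [Kolyvagin1989Izv] Thm. B₂; [Miller2011LMS]
Def. 1.1; [Kramer1981] Thm. 1.
-/

set_option autoImplicit false
set_option linter.dupNamespace false -- `Summit.<P>.<Sub>` repeats `BirchSwinnertonDyer` (D-0017)

noncomputable section

open scoped Classical

namespace Summit.BirchSwinnertonDyer.BirchSwinnertonDyer.Theorems.GenusExact.ValuationLedger

open WeierstrassCurve NumberField IsDedekindDomain Field Literature.NumberTheory.EllipticCurves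
  Literature.NumberTheory.GaloisRepresentations Literature.NumberTheory.EllipticCurves.ModularForms
  Literature.NumberTheory.EllipticCurves.RingClassField
  Summit.BirchSwinnertonDyer.Rank1Residual
  Summit.BirchSwinnertonDyer.Rank1Residual.AdditivePotMult
  Summit.BirchSwinnertonDyer.BirchSwinnertonDyer.Theses.GenusKolyvaginAtTwo
  Summit.BirchSwinnertonDyer.BirchSwinnertonDyer.Theorems.RankOneAtTwoOneDoor
  Summit.BirchSwinnertonDyer.BirchSwinnertonDyer.Theorems.GenusExact.PlusDescent

/-! ## §1 Rationality of `#Ш_an(Wd)` from `#Ш_an(E)` -/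

/-- **`#Ш_an(Wd)` is rational when `#Ш_an(E)` is**, on any supply frame (`E = W/ℚ` globally minimal of analytic rank `0`, `ρ̄_{E,2}` onto, odd `C(E)`;
`K` imaginary quadratic with `d_K` odd `≠ −3`, Heegner; a datum `Dt`, `d₁` with `2^(M₀) ∥ P(1)`; a globally minimal twin `Wd` of analytic rank `1`):
Milne's Weil-restriction identity `#Ш_an(E_K)·#Ш(E)·#Ш(Wd) = #Ш_an(E)·#Ш_an(Wd)·#Ш(E_K)` with `#Ш_an(E_K) ∈ ℚ` (Gross–Zagier over `K`).  CONDITIONAL on the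
four print items. [cite: Milne1972ArithmeticAV, §1 Thm. 1] [cite: GrossZagier1986, V §2 (2.2)] -/
theorem exists_rat_shaAn_twin
    (hGZ : GrossZagierAllLevels) (hGZK : MultPublishedInputsAtTwo) (hL : EntireLFunctionRat) (hMi : MilneAnyModel)
    (W : WeierstrassCurve ℚ) [W.IsElliptic] [W.IsGloballyMinimal] [NeZero (W.conductorNorm ℤ)]
    (hρ2 : W.HasSurjectiveModNGaloisRep 2) (hT : Odd W.tamagawaProduct) (hr0 : W.analyticRank = 0)
    (K : Type) [Field K] [NumberField K] (hIQ : IsImaginaryQuadratic K) (hodd : Odd (NumberField.discr K))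
    (h3 : NumberField.discr K ≠ -3) (hHe : SatisfiesHeegnerHypothesis (W.conductorNorm ℤ) K)
    (Dt : ModularParametrizationData W (W.conductorNorm ℤ)) (β : ℤ) (ι : K →+* ℂ)
    (d₁ : KolyvaginHeegnerData Dt β ι 1) {M₀ : ℕ}
    (hdiv : ∃ Q : (W.baseChange (ringClassField K ι 1)).toAffine.Point, ((2 ^ M₀ : ℕ) : ℤ) • Q = d₁.derivedPoint)
    (hndiv : ¬ ∃ Q : (W.baseChange (ringClassField K ι 1)).toAffine.Point, ((2 ^ (M₀ + 1) : ℕ) : ℤ) • Q = d₁.derivedPoint)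
    (Wd : WeierstrassCurve ℚ) [Wd.IsElliptic] [Wd.IsGloballyMinimal]
    (hWd : ∃ C : VariableChange ℚ, C • W.quadraticTwist (NumberField.discr K : ℚ) = Wd) (hrd : Wd.analyticRank = 1)
    {qW : ℚ} (hqW : shaAn W = (qW : ℂ)) :
    ∃ qd : ℚ, shaAn Wd = (qd : ℂ) := by
  haveI : Fact (Nat.Prime 2) := ⟨Nat.prime_two⟩
  haveI hEK : (W.baseChange K).IsElliptic := inferInstanceAs ((W.map (algebraMap ℚ K)).IsElliptic)
  have h2 : Module.finrank ℚ K = 2 := hIQ.1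
  have hD0 : (NumberField.discr K : ℚ) ≠ 0 := by exact_mod_cast NumberField.discr_ne_zero K
  haveI hEt : (W.quadraticTwist (NumberField.discr K : ℚ)).IsElliptic := W.isElliptic_quadraticTwist hD0
  have hrt : (W.quadraticTwist (NumberField.discr K : ℚ)).analyticRank = 1 := by
    obtain ⟨Cd, hCd⟩ := hWd
    rw [← hrd, ← hCd, analyticRank_smul]
  have hrK : (W.baseChange K).analyticRank = 1 :=
    (P2.analyticRank_baseChange_eq_one_iff W K hL h2).mpr (Or.inr ⟨hr0, hrt⟩)
  obtain ⟨hShaK, q', hq', -⟩ :=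
    padicValRat_shaAnOverC_heegnerC W K Dt β ι d₁ (hGZ _ W K) hGZK hL hρ2 hT hIQ hodd h3 hHe hrK hdiv hndiv
  obtain ⟨-, hfinW⟩ := hGZK W (by rw [hr0]; exact zero_le_one)
  obtain ⟨-, hfinD⟩ := hGZK Wd (by rw [hrd])
  have hV : ∃ C : VariableChange K, C • W.baseChange K = W.baseChange K := ⟨1, one_smul _ _⟩
  obtain ⟨-, hWR⟩ := hMi W K h2 Wd hWd (W.baseChange K) hV hfinW hfinD
  have hstar := shaAnOverC_mul_eq W K Wd (W.baseChange K) hL h2 hWd hV hfinW hfinD hWR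
  have hsK : (W.baseChange K).shaOrder ≠ 0 := ((W.baseChange K).shaOrder_pos hShaK).ne'
  have hqW0 : (qW : ℂ) ≠ 0 := by rw [← hqW]; exact shaAn_ne_zero W hL
  have hden : (qW : ℂ) * ((W.baseChange K).shaOrder : ℂ) ≠ 0 := mul_ne_zero hqW0 (by exact_mod_cast hsK)
  refine ⟨q' * W.shaOrder * Wd.shaOrder / (qW * (W.baseChange K).shaOrder), ?_⟩
  push_cast
  rw [eq_div_iff hden, ← hqW, ← hq']
  linear_combination -hstar

/-! ## §2 A K₄ witness is the cancellation of the two BSD₂-defects (mod Q2 + PRINT, on the cut) -/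

/-- **K₄⁻ WITNESS ⟺ DEFECT CANCELLATION.**  Frame = the K4Neg item binders (habitat curve `E` with `Δ < 0`, `#Sel₂(E) = 4`, admissible prime frame
`K = ℚ(√−ℓ₀)` with `2` split, the two B₂ non-squares, odd-Manin `Dt`, `d₁` with `2^(M₀) ∥ P(1)`, `M₀ ≥ 1`, the `Sel₂`-minimal rank-one twin `Wd` with
`ord₂ C(Wd) ≤ 1`) + one odd multiplicative prime `v` + Q2 + PRINT; `#Ш_an(E) = qW`, `#Ш_an(Wd) = qd` rational.  Then
**(∃ square-free deep `n` with `P(n) ∉ 2E(K[n])`) ⟺ `ord₂ #Ш(E/ℚ)[2^∞] = ord₂ qW + ord₂ qd`** — ★★ (`kFourNeg_conclusion_iff_natCard_sha_rat_eq_pow`: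
witness ⟺ `#Ш(E/ℚ)[2^∞] = 2^(2M₀)`) + the one-frame ledger `2·M₀ = ord₂ qW + ord₂ qd`.  CONDITIONAL (Q2, PRINT); BSD / K4Neg NOT proved.
[cite: McCallumLMS1991, §5 Thm. 5.4] [cite: Kolyvagin1989Izv, Thm. B₂] [cite: GrossZagier1986, V §2 (2.2)] [cite: Milne1972ArithmeticAV, §1 Thm. 1] -/
theorem kFourNeg_witness_iff_defects_cancel
    (hGZ : GrossZagierAllLevels) (hGZK : MultPublishedInputsAtTwo) (hL : EntireLFunctionRat) (hMi : MilneAnyModel)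
    (hQ2 : KolyvaginRelationAtTwo)
    (W : WeierstrassCurve ℚ) [W.IsElliptic] [W.IsGloballyMinimal] [NeZero (W.conductorNorm ℤ)] (hcm : ¬ W.HasCM)
    (hr0 : W.analyticRank = 0) (hρ : ∀ n : ℕ, 0 < n → W.HasSurjectiveModNGaloisRep ((2 : ℤ) ^ n)) (hT : Odd W.tamagawaProduct)
    (hneg : W.Δ < 0) (h4 : Nat.card (W.selmerGroup 2) = 4)
    (K : Type) [Field K] [NumberField K] (hIQ : IsImaginaryQuadratic K) (hodd : Odd (NumberField.discr K))
    (h3 : NumberField.discr K ≠ -3) (hHe : SatisfiesHeegnerHypothesis (W.conductorNorm ℤ) K)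
    (hsq1 : ¬ IsSquare ((NumberField.discr K : ℚ) * -|W.Δ|)) (hsq2 : ¬ IsSquare ((NumberField.discr K : ℚ) * (-(2 * |W.Δ|))))
    (ℓ₀ : ℕ) (hℓ₀ : ℓ₀.Prime) (hdK : NumberField.discr K = -(ℓ₀ : ℤ))
    (h2K : ((Ideal.span {(2 : ℤ)}).primesOver (𝓞 K)).ncard = 2)
    (Dt : ModularParametrizationData W (W.conductorNorm ℤ))
    (hopt : ∀ z ∈ Dt.L.lattice, ∃ w ∈ periodLattice Dt.f, z = (Dt.c : ℂ) * w) (hc : Odd Dt.c)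
    (β : ℤ) (ι : K →+* ℂ) (d₁ : KolyvaginHeegnerData Dt β ι 1) (hy : ¬ IsOfFinAddOrder d₁.derivedPoint) (M₀ : ℕ)
    (hdiv : ∃ Q : (W.baseChange (ringClassField K ι 1)).toAffine.Point, ((2 ^ M₀ : ℕ) : ℤ) • Q = d₁.derivedPoint)
    (hndiv : ¬ ∃ Q : (W.baseChange (ringClassField K ι 1)).toAffine.Point, ((2 ^ (M₀ + 1) : ℕ) : ℤ) • Q = d₁.derivedPoint)
    (hM₀ : 1 ≤ M₀) (Wd : WeierstrassCurve ℚ) [Wd.IsElliptic] [Wd.IsGloballyMinimal]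
    (hWd : ∃ C : VariableChange ℚ, C • W.quadraticTwist (NumberField.discr K : ℚ) = Wd) (hrd : Wd.analyticRank = 1)
    (hSel : Nat.card (Wd.selmerGroup 2) = 2) (hDEF : padicValNat 2 Wd.tamagawaProduct ≤ 1)
    (v : HeightOneSpectrum (𝓞 ℚ)) (h2v : ((2 : ℕ) : 𝓞 ℚ) ∉ v.asIdeal) (hNv : ((W.conductorNorm ℤ : ℕ) : 𝓞 ℚ) ∈ v.asIdeal)
    (hmult : W.HasMultiplicativeReductionAt v)
    {qW qd : ℚ} (hqW : shaAn W = (qW : ℂ)) (hqd : shaAn Wd = (qd : ℂ)) :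
    (∃ (n : ℕ) (d : KolyvaginHeegnerData Dt β ι n), Squarefree n ∧
      (∀ ℓ ∈ n.primeFactors, Zhang2014.IsKolyvaginPrime (W.conductorNorm ℤ) W K 2 ℓ ∧ 2 ≤ Zhang2014.kolyvaginIndex W 2 ℓ ∧
        FrobEqFrobInfty W K 2 ℓ) ∧
      ¬ ∃ Q : (W.baseChange (ringClassField K ι n)).toAffine.Point, (2 : ℤ) • Q = d.derivedPoint) ↔
    (padicValNat 2 (Nat.card (AddCommGroup.primaryComponent (↥W.sha) 2)) : ℤ) = padicValRat 2 qW + padicValRat 2 qd := by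
  haveI : Fact (Nat.Prime 2) := ⟨Nat.prime_two⟩
  -- the one-frame ledger `2·M₀ = ord₂ qW + ord₂ qd`
  obtain ⟨qW', hqW', hledger⟩ := k4Neg_frameLedger_eq hGZ hGZK hL hMi W hr0 hρ hT hneg h4 Dt hc K hIQ hodd h3 hHe hsq1 ℓ₀ hℓ₀ hdK h2K β ι d₁
    hy hdiv hndiv Wd hWd hrd hSel hqd
  have hqq : qW' = qW := Rat.cast_injective (α := ℂ) (hqW'.symm.trans hqW)
  rw [hqq] at hledger
  -- ★★
  rw [GenusSupplyNarrow.KFourCell.ShaCardCurrency.kFourNeg_conclusion_iff_natCard_sha_rat_eq_pow hQ2 W hcm hr0 hρ hT hneg h4 K hIQ hodd h3 hHe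
    hsq1 hsq2 ℓ₀ hℓ₀ hdK h2K Dt hopt hc β ι d₁ hy M₀ hdiv hndiv hM₀ Wd hWd hrd hSel hDEF v h2v hNv hmult]
  constructor
  · intro h
    rw [h, padicValNat.prime_pow]
    push_cast
    linarith
  · intro h
    obtain ⟨-, hfinW⟩ := hGZK W (by rw [hr0]; exact zero_le_one)
    haveI : Finite (↥W.sha) := hfinW
    obtain ⟨k, hk⟩ := exists_natCard_addPrimaryComponent_eq_pow (A := ↥W.sha) 2
    rw [hk, padicValNat.prime_pow] at h
    have hk2 : (k : ℤ) = 2 * M₀ := by linarith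
    rw [hk]
    congr 1
    exact_mod_cast hk2

/-- **K₄⁺ WITNESS ⟺ DEFECT CANCELLATION.**  Frame = the K4Pos item binders (habitat curve `E` with `Δ > 0`, real-narrow `#Sel₂(E) = 4`, admissible prime
frame with `2` split, the two B₂ non-squares, odd-Manin `Dt`, `d₁` with `2^(M₀) ∥ P(1)`, `M₀ ≥ 1`, the shallow `Sel₂`-minimal rank-one twin `Wd`) + one
odd multiplicative prime `v` + Q2 + PRINT; `#Ш_an(E) = qW`, `#Ш_an(Wd) = qd` rational.  Then **(∃ square-free transposition-deep `n` with
`P(n) ∉ 2E(K[n])`) ⟺ `ord₂ #Ш(E/ℚ)[2^∞] = ord₂ qW + ord₂ qd`** — ★★⁺ (`ShaCores.kFourPos_witness_iff_natCard_shaPrimary_rat_eq_pow`) + the one-frame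
ledger.  CONDITIONAL (Q2, PRINT); BSD / K4Pos NOT proved. [cite: McCallumLMS1991, §5 Thm. 5.4] [cite: Kolyvagin1989Izv, Thm. B₂]
[cite: GrossZagier1986, V §2 (2.2)] [cite: Milne1972ArithmeticAV, §1 Thm. 1] -/
theorem kFourPos_witness_iff_defects_cancel
    (hGZ : GrossZagierAllLevels) (hGZK : MultPublishedInputsAtTwo) (hL : EntireLFunctionRat) (hMi : MilneAnyModel)
    (hQ2 : KolyvaginRelationAtTwo)
    (W : WeierstrassCurve ℚ) [W.IsElliptic] [W.IsGloballyMinimal] [NeZero (W.conductorNorm ℤ)] (hcm : ¬ W.HasCM)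
    (hr0 : W.analyticRank = 0) (hρ : ∀ n : ℕ, 0 < n → W.HasSurjectiveModNGaloisRep ((2 : ℤ) ^ n)) (hT : Odd W.tamagawaProduct)
    (hpos : 0 < W.Δ)
    (h4 : Nat.card (W.selmerGroup 2) = 4 ∧ ∃ c ∈ (W.kummerSelmerStructure ((2 : ℕ) : ℤ)).selmerGroup,
      galoisCohomology.localization (W.torsionGaloisModule ((2 : ℕ) : ℤ)) (Sum.inl Rat.infinitePlace) 1 c ≠ 0)
    (K : Type) [Field K] [NumberField K] (hIQ : IsImaginaryQuadratic K) (hodd : Odd (NumberField.discr K))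
    (h3 : NumberField.discr K ≠ -3) (hHe : SatisfiesHeegnerHypothesis (W.conductorNorm ℤ) K)
    (hsq1 : ¬ IsSquare ((NumberField.discr K : ℚ) * -|W.Δ|)) (hsq2 : ¬ IsSquare ((NumberField.discr K : ℚ) * (-(2 * |W.Δ|))))
    (ℓ₀ : ℕ) (_hℓ₀ : ℓ₀.Prime) (_hdK : NumberField.discr K = -(ℓ₀ : ℤ))
    (h2K : ((Ideal.span {(2 : ℤ)}).primesOver (𝓞 K)).ncard = 2)
    (Dt : ModularParametrizationData W (W.conductorNorm ℤ)) (hc : Odd Dt.c)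
    (β : ℤ) (ι : K →+* ℂ) (d₁ : KolyvaginHeegnerData Dt β ι 1) (hy : ¬ IsOfFinAddOrder d₁.derivedPoint) (M₀ : ℕ)
    (hdiv : ∃ Q : (W.baseChange (ringClassField K ι 1)).toAffine.Point, ((2 ^ M₀ : ℕ) : ℤ) • Q = d₁.derivedPoint)
    (hndiv : ¬ ∃ Q : (W.baseChange (ringClassField K ι 1)).toAffine.Point, ((2 ^ (M₀ + 1) : ℕ) : ℤ) • Q = d₁.derivedPoint)
    (hM₀ : 1 ≤ M₀) (Wd : WeierstrassCurve ℚ) [Wd.IsElliptic] [Wd.IsGloballyMinimal]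
    (hWd : ∃ C : VariableChange ℚ, C • W.quadraticTwist (NumberField.discr K : ℚ) = Wd) (hrd : Wd.analyticRank = 1)
    (hSel : Nat.card (Wd.selmerGroup 2) = 2) (hDEF : padicValNat 2 Wd.tamagawaProduct = 0)
    (v : HeightOneSpectrum (𝓞 ℚ)) (h2v : ((2 : ℕ) : 𝓞 ℚ) ∉ v.asIdeal) (hNv : ((W.conductorNorm ℤ : ℕ) : 𝓞 ℚ) ∈ v.asIdeal)
    (hmult : W.HasMultiplicativeReductionAt v)
    {qW qd : ℚ} (hqW : shaAn W = (qW : ℂ)) (hqd : shaAn Wd = (qd : ℂ)) :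
    (∃ (n : ℕ) (d : KolyvaginHeegnerData Dt β ι n), Squarefree n ∧
      (∀ ℓ ∈ n.primeFactors, Zhang2014.IsKolyvaginPrime (W.conductorNorm ℤ) W K 2 ℓ ∧ 2 ≤ Zhang2014.kolyvaginIndex W 2 ℓ ∧
        ∃ (v : HeightOneSpectrum (𝓞 ℚ)) (𝔓 : Ideal (absIntegers (𝓞 ℚ) ℚ)) (h : absoluteGaloisGroup ℚ),
          ((ℓ : ℕ) : 𝓞 ℚ) ∈ v.asIdeal ∧ 𝔓 ∈ v.primesAbove ∧ IsArithFrobAt (𝓞 ℚ) h 𝔓 ∧ ∃ u : W.geomTorsion ((2 : ℕ) : ℤ), h • u ≠ u) ∧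
      ¬ ∃ Q : (W.baseChange (ringClassField K ι n)).toAffine.Point, (2 : ℤ) • Q = d.derivedPoint) ↔
    (padicValNat 2 (Nat.card (AddCommGroup.primaryComponent (↥W.sha) 2)) : ℤ) = padicValRat 2 qW + padicValRat 2 qd := by
  haveI : Fact (Nat.Prime 2) := ⟨Nat.prime_two⟩
  -- the one-frame ledger `2·M₀ = ord₂ qW + ord₂ qd`
  obtain ⟨qW', hqW', hledger⟩ := k4Pos_frameLedger_eq hGZ hGZK hL hMi W hr0 hρ hT hpos h4 Dt hc K hIQ hodd h3 hHe h2K β ι d₁ hy hdiv hndiv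
    Wd hWd hrd hSel hDEF hqd
  have hqq : qW' = qW := Rat.cast_injective (α := ℂ) (hqW'.symm.trans hqW)
  rw [hqq] at hledger
  -- ★★⁺
  obtain ⟨σ₀, hσ₀, -⟩ := exists_conj_of_isImaginaryQuadratic (K := K) hIQ
  obtain ⟨Cd, hCd⟩ := hWd
  rw [ShaCores.kFourPos_witness_iff_natCard_shaPrimary_rat_eq_pow W K hQ2 hcm hT v h2v hNv hmult hpos hIQ hodd h3 hHe hsq1 hsq2 hρ Dt β ι d₁ hy
    M₀ hM₀ hdiv hndiv Wd Cd hCd hSel hDEF h4 hr0 h2K hσ₀]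
  constructor
  · intro h
    rw [h, show (4 : ℕ) = 2 ^ 2 by norm_num, ← pow_mul, padicValNat.prime_pow]
    push_cast
    linarith
  · intro h
    obtain ⟨-, hfinW⟩ := hGZK W (by rw [hr0]; exact zero_le_one)
    haveI : Finite (↥W.sha) := hfinW
    obtain ⟨k, hk⟩ := exists_natCard_addPrimaryComponent_eq_pow (A := ↥W.sha) 2
    rw [hk, padicValNat.prime_pow] at h
    have hk2 : k = 2 * M₀ := by exact_mod_cast (show (k : ℤ) = 2 * M₀ by linarith)
    rw [hk, hk2, pow_mul]
    norm_num

/-! ## §3 The new leg: `BSD₂(E)` + a K₄ witness ⟹ `BSD₂(E^(d_K))` -/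

/-- **`BSD₂(E)` ∧ K₄⁻-witness ⟹ `BSD₂(Wd)`** on the K₄⁻ cut cell (mod Q2 + PRINT): the witness makes the two BSD₂-defects cancel (§2), `BSD₂(E)` says
`δ(E) = 0`, so `ord₂ #Ш_an(Wd) = 0 = ord₂ #Ш(Wd)[2^∞]` (`Ш(Wd)[2^∞] = 0`: rank one, `#Sel₂ = 2`); `rank Wd(ℚ) = r_an = 1` and finiteness by GZK.
With `LeafCurrency.kFourNeg_conclusion_iff_bsdp` (`BSD₂(Wd)` ∧ witness ⟹ `BSD₂(E)`) and Lossless §2 this is «two out of three».  CONDITIONAL;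
BSD / K4Neg NOT proved. [cite: Miller2011LMS, Def. 1.1] [cite: GrossZagier1986, V §2 (2.2)] [cite: Milne1972ArithmeticAV, §1 Thm. 1] -/
theorem bsdp_twin_of_kFourNeg_witness_of_bsdp
    (hGZ : GrossZagierAllLevels) (hGZK : MultPublishedInputsAtTwo) (hL : EntireLFunctionRat) (hMi : MilneAnyModel)
    (hQ2 : KolyvaginRelationAtTwo)
    (W : WeierstrassCurve ℚ) [W.IsElliptic] [W.IsGloballyMinimal] [NeZero (W.conductorNorm ℤ)] (hcm : ¬ W.HasCM)
    (hr0 : W.analyticRank = 0) (hρ : ∀ n : ℕ, 0 < n → W.HasSurjectiveModNGaloisRep ((2 : ℤ) ^ n)) (hT : Odd W.tamagawaProduct)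
    (hneg : W.Δ < 0) (h4 : Nat.card (W.selmerGroup 2) = 4)
    (K : Type) [Field K] [NumberField K] (hIQ : IsImaginaryQuadratic K) (hodd : Odd (NumberField.discr K))
    (h3 : NumberField.discr K ≠ -3) (hHe : SatisfiesHeegnerHypothesis (W.conductorNorm ℤ) K)
    (hsq1 : ¬ IsSquare ((NumberField.discr K : ℚ) * -|W.Δ|)) (hsq2 : ¬ IsSquare ((NumberField.discr K : ℚ) * (-(2 * |W.Δ|))))
    (ℓ₀ : ℕ) (hℓ₀ : ℓ₀.Prime) (hdK : NumberField.discr K = -(ℓ₀ : ℤ))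
    (h2K : ((Ideal.span {(2 : ℤ)}).primesOver (𝓞 K)).ncard = 2)
    (Dt : ModularParametrizationData W (W.conductorNorm ℤ))
    (hopt : ∀ z ∈ Dt.L.lattice, ∃ w ∈ periodLattice Dt.f, z = (Dt.c : ℂ) * w) (hc : Odd Dt.c)
    (β : ℤ) (ι : K →+* ℂ) (d₁ : KolyvaginHeegnerData Dt β ι 1) (hy : ¬ IsOfFinAddOrder d₁.derivedPoint) (M₀ : ℕ)
    (hdiv : ∃ Q : (W.baseChange (ringClassField K ι 1)).toAffine.Point, ((2 ^ M₀ : ℕ) : ℤ) • Q = d₁.derivedPoint)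
    (hndiv : ¬ ∃ Q : (W.baseChange (ringClassField K ι 1)).toAffine.Point, ((2 ^ (M₀ + 1) : ℕ) : ℤ) • Q = d₁.derivedPoint)
    (hM₀ : 1 ≤ M₀) (Wd : WeierstrassCurve ℚ) [Wd.IsElliptic] [Wd.IsGloballyMinimal]
    (hWd : ∃ C : VariableChange ℚ, C • W.quadraticTwist (NumberField.discr K : ℚ) = Wd) (hrd : Wd.analyticRank = 1)
    (hSel : Nat.card (Wd.selmerGroup 2) = 2) (hDEF : padicValNat 2 Wd.tamagawaProduct ≤ 1)
    (v : HeightOneSpectrum (𝓞 ℚ)) (h2v : ((2 : ℕ) : 𝓞 ℚ) ∉ v.asIdeal) (hNv : ((W.conductorNorm ℤ : ℕ) : 𝓞 ℚ) ∈ v.asIdeal)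
    (hmult : W.HasMultiplicativeReductionAt v)
    (hBW : BSDp W 2)
    (hK4 : ∃ (n : ℕ) (d : KolyvaginHeegnerData Dt β ι n), Squarefree n ∧
      (∀ ℓ ∈ n.primeFactors, Zhang2014.IsKolyvaginPrime (W.conductorNorm ℤ) W K 2 ℓ ∧ 2 ≤ Zhang2014.kolyvaginIndex W 2 ℓ ∧
        FrobEqFrobInfty W K 2 ℓ) ∧
      ¬ ∃ Q : (W.baseChange (ringClassField K ι n)).toAffine.Point, (2 : ℤ) • Q = d.derivedPoint) :
    BSDp Wd 2 := by
  haveI : Fact (Nat.Prime 2) := ⟨Nat.prime_two⟩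
  have hρ2 : W.HasSurjectiveModNGaloisRep 2 := by simpa using hρ 1 one_pos
  obtain ⟨-, -, qW, hqW, hvW⟩ := hBW
  obtain ⟨qd, hqd⟩ := exists_rat_shaAn_twin hGZ hGZK hL hMi W hρ2 hT hr0 K hIQ hodd h3 hHe Dt β ι d₁ hdiv hndiv Wd hWd hrd hqW
  have hcancel := (kFourNeg_witness_iff_defects_cancel hGZ hGZK hL hMi hQ2 W hcm hr0 hρ hT hneg h4 K hIQ hodd h3 hHe hsq1 hsq2 ℓ₀ hℓ₀ hdK h2K
    Dt hopt hc β ι d₁ hy M₀ hdiv hndiv hM₀ Wd hWd hrd hSel hDEF v h2v hNv hmult hqW hqd).mp hK4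
  obtain ⟨hrk, hfinD⟩ := hGZK Wd (by rw [hrd])
  haveI : Finite (↥Wd.sha) := hfinD
  refine ⟨hrk, inferInstance, qd, hqd, ?_⟩
  rw [natCard_primaryComponent_sha_two_eq_one_of_rank_one Wd (hrk.trans hrd) hSel, padicValNat_one_right]
  push_cast
  linarith

/-- **`BSD₂(E)` ∧ K₄⁺-witness ⟹ `BSD₂(Wd)`** on the K₄⁺ cut cell (mod Q2 + PRINT) — the Δ>0 twin of `bsdp_twin_of_kFourNeg_witness_of_bsdp`.
CONDITIONAL; BSD / K4Pos NOT proved. [cite: Miller2011LMS, Def. 1.1] [cite: GrossZagier1986, V §2 (2.2)] [cite: Milne1972ArithmeticAV, §1 Thm. 1] -/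
theorem bsdp_twin_of_kFourPos_witness_of_bsdp
    (hGZ : GrossZagierAllLevels) (hGZK : MultPublishedInputsAtTwo) (hL : EntireLFunctionRat) (hMi : MilneAnyModel)
    (hQ2 : KolyvaginRelationAtTwo)
    (W : WeierstrassCurve ℚ) [W.IsElliptic] [W.IsGloballyMinimal] [NeZero (W.conductorNorm ℤ)] (hcm : ¬ W.HasCM)
    (hr0 : W.analyticRank = 0) (hρ : ∀ n : ℕ, 0 < n → W.HasSurjectiveModNGaloisRep ((2 : ℤ) ^ n)) (hT : Odd W.tamagawaProduct)
    (hpos : 0 < W.Δ)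
    (h4 : Nat.card (W.selmerGroup 2) = 4 ∧ ∃ c ∈ (W.kummerSelmerStructure ((2 : ℕ) : ℤ)).selmerGroup,
      galoisCohomology.localization (W.torsionGaloisModule ((2 : ℕ) : ℤ)) (Sum.inl Rat.infinitePlace) 1 c ≠ 0)
    (K : Type) [Field K] [NumberField K] (hIQ : IsImaginaryQuadratic K) (hodd : Odd (NumberField.discr K))
    (h3 : NumberField.discr K ≠ -3) (hHe : SatisfiesHeegnerHypothesis (W.conductorNorm ℤ) K)
    (hsq1 : ¬ IsSquare ((NumberField.discr K : ℚ) * -|W.Δ|)) (hsq2 : ¬ IsSquare ((NumberField.discr K : ℚ) * (-(2 * |W.Δ|))))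
    (ℓ₀ : ℕ) (hℓ₀ : ℓ₀.Prime) (hdK : NumberField.discr K = -(ℓ₀ : ℤ))
    (h2K : ((Ideal.span {(2 : ℤ)}).primesOver (𝓞 K)).ncard = 2)
    (Dt : ModularParametrizationData W (W.conductorNorm ℤ)) (hc : Odd Dt.c)
    (β : ℤ) (ι : K →+* ℂ) (d₁ : KolyvaginHeegnerData Dt β ι 1) (hy : ¬ IsOfFinAddOrder d₁.derivedPoint) (M₀ : ℕ)
    (hdiv : ∃ Q : (W.baseChange (ringClassField K ι 1)).toAffine.Point, ((2 ^ M₀ : ℕ) : ℤ) • Q = d₁.derivedPoint)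
    (hndiv : ¬ ∃ Q : (W.baseChange (ringClassField K ι 1)).toAffine.Point, ((2 ^ (M₀ + 1) : ℕ) : ℤ) • Q = d₁.derivedPoint)
    (hM₀ : 1 ≤ M₀) (Wd : WeierstrassCurve ℚ) [Wd.IsElliptic] [Wd.IsGloballyMinimal]
    (hWd : ∃ C : VariableChange ℚ, C • W.quadraticTwist (NumberField.discr K : ℚ) = Wd) (hrd : Wd.analyticRank = 1)
    (hSel : Nat.card (Wd.selmerGroup 2) = 2) (hDEF : padicValNat 2 Wd.tamagawaProduct = 0)
    (v : HeightOneSpectrum (𝓞 ℚ)) (h2v : ((2 : ℕ) : 𝓞 ℚ) ∉ v.asIdeal) (hNv : ((W.conductorNorm ℤ : ℕ) : 𝓞 ℚ) ∈ v.asIdeal)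
    (hmult : W.HasMultiplicativeReductionAt v)
    (hBW : BSDp W 2)
    (hK4 : ∃ (n : ℕ) (d : KolyvaginHeegnerData Dt β ι n), Squarefree n ∧
      (∀ ℓ ∈ n.primeFactors, Zhang2014.IsKolyvaginPrime (W.conductorNorm ℤ) W K 2 ℓ ∧ 2 ≤ Zhang2014.kolyvaginIndex W 2 ℓ ∧
        ∃ (v : HeightOneSpectrum (𝓞 ℚ)) (𝔓 : Ideal (absIntegers (𝓞 ℚ) ℚ)) (h : absoluteGaloisGroup ℚ),
          ((ℓ : ℕ) : 𝓞 ℚ) ∈ v.asIdeal ∧ 𝔓 ∈ v.primesAbove ∧ IsArithFrobAt (𝓞 ℚ) h 𝔓 ∧ ∃ u : W.geomTorsion ((2 : ℕ) : ℤ), h • u ≠ u) ∧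
      ¬ ∃ Q : (W.baseChange (ringClassField K ι n)).toAffine.Point, (2 : ℤ) • Q = d.derivedPoint) :
    BSDp Wd 2 := by
  haveI : Fact (Nat.Prime 2) := ⟨Nat.prime_two⟩
  have hρ2 : W.HasSurjectiveModNGaloisRep 2 := by simpa using hρ 1 one_pos
  obtain ⟨-, -, qW, hqW, hvW⟩ := hBW
  obtain ⟨qd, hqd⟩ := exists_rat_shaAn_twin hGZ hGZK hL hMi W hρ2 hT hr0 K hIQ hodd h3 hHe Dt β ι d₁ hdiv hndiv Wd hWd hrd hqW
  have hcancel := (kFourPos_witness_iff_defects_cancel hGZ hGZK hL hMi hQ2 W hcm hr0 hρ hT hpos h4 K hIQ hodd h3 hHe hsq1 hsq2 ℓ₀ hℓ₀ hdK h2K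
    Dt hc β ι d₁ hy M₀ hdiv hndiv hM₀ Wd hWd hrd hSel hDEF v h2v hNv hmult hqW hqd).mp hK4
  obtain ⟨hrk, hfinD⟩ := hGZK Wd (by rw [hrd])
  haveI : Finite (↥Wd.sha) := hfinD
  refine ⟨hrk, inferInstance, qd, hqd, ?_⟩
  rw [natCard_primaryComponent_sha_two_eq_one_of_rank_one Wd (hrk.trans hrd) hSel, padicValNat_one_right]
  push_cast
  linarith

/-! ## §4 Given the rank-zero wall at `E`, the K₄ supply IS `BSD₂` of the cell's own twin (mod Q2 + PRINT, on the cut) -/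

/-- **GIVEN `BSD₂(E)`: K₄⁻-witness at the frame ⟺ `BSD₂(E^(d_K))`** (K₄⁻ cut cell, mod Q2 + PRINT).  (→) §3; (←) the LEAD leaf currency
`LeafCurrency.kFourNeg_conclusion_iff_bsdp` (`.mpr`).  READING: once WALL row 1 is granted at `E`, the K₄⁻ supply is the route item U₂ on the cell's twins,
no more and no less.  CONDITIONAL; BSD / K4Neg / U₂ NOT proved. [cite: McCallumLMS1991, §5 Thm. 5.4] [cite: Miller2011LMS, Def. 1.1]
[cite: GrossZagier1986, V §2 (2.2)] [cite: Milne1972ArithmeticAV, §1 Thm. 1] -/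
theorem kFourNeg_witness_iff_bsdp_twin_of_bsdp
    (hGZ : GrossZagierAllLevels) (hGZK : MultPublishedInputsAtTwo) (hL : EntireLFunctionRat) (hMi : MilneAnyModel)
    (hQ2 : KolyvaginRelationAtTwo)
    (W : WeierstrassCurve ℚ) [W.IsElliptic] [W.IsGloballyMinimal] [NeZero (W.conductorNorm ℤ)] (hcm : ¬ W.HasCM)
    (hr0 : W.analyticRank = 0) (hρ : ∀ n : ℕ, 0 < n → W.HasSurjectiveModNGaloisRep ((2 : ℤ) ^ n)) (hT : Odd W.tamagawaProduct)
    (hneg : W.Δ < 0) (h4 : Nat.card (W.selmerGroup 2) = 4)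
    (K : Type) [Field K] [NumberField K] (hIQ : IsImaginaryQuadratic K) (hodd : Odd (NumberField.discr K))
    (h3 : NumberField.discr K ≠ -3) (hHe : SatisfiesHeegnerHypothesis (W.conductorNorm ℤ) K)
    (hsq1 : ¬ IsSquare ((NumberField.discr K : ℚ) * -|W.Δ|)) (hsq2 : ¬ IsSquare ((NumberField.discr K : ℚ) * (-(2 * |W.Δ|))))
    (ℓ₀ : ℕ) (hℓ₀ : ℓ₀.Prime) (hdK : NumberField.discr K = -(ℓ₀ : ℤ))
    (h2K : ((Ideal.span {(2 : ℤ)}).primesOver (𝓞 K)).ncard = 2)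
    (Dt : ModularParametrizationData W (W.conductorNorm ℤ))
    (hopt : ∀ z ∈ Dt.L.lattice, ∃ w ∈ periodLattice Dt.f, z = (Dt.c : ℂ) * w) (hc : Odd Dt.c)
    (β : ℤ) (ι : K →+* ℂ) (d₁ : KolyvaginHeegnerData Dt β ι 1) (hy : ¬ IsOfFinAddOrder d₁.derivedPoint) (M₀ : ℕ)
    (hdiv : ∃ Q : (W.baseChange (ringClassField K ι 1)).toAffine.Point, ((2 ^ M₀ : ℕ) : ℤ) • Q = d₁.derivedPoint)
    (hndiv : ¬ ∃ Q : (W.baseChange (ringClassField K ι 1)).toAffine.Point, ((2 ^ (M₀ + 1) : ℕ) : ℤ) • Q = d₁.derivedPoint)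
    (hM₀ : 1 ≤ M₀) (Wd : WeierstrassCurve ℚ) [Wd.IsElliptic] [Wd.IsGloballyMinimal]
    (hWd : ∃ C : VariableChange ℚ, C • W.quadraticTwist (NumberField.discr K : ℚ) = Wd) (hrd : Wd.analyticRank = 1)
    (hSel : Nat.card (Wd.selmerGroup 2) = 2) (hDEF : padicValNat 2 Wd.tamagawaProduct ≤ 1)
    (v : HeightOneSpectrum (𝓞 ℚ)) (h2v : ((2 : ℕ) : 𝓞 ℚ) ∉ v.asIdeal) (hNv : ((W.conductorNorm ℤ : ℕ) : 𝓞 ℚ) ∈ v.asIdeal)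
    (hmult : W.HasMultiplicativeReductionAt v)
    (hBW : BSDp W 2) :
    (∃ (n : ℕ) (d : KolyvaginHeegnerData Dt β ι n), Squarefree n ∧
      (∀ ℓ ∈ n.primeFactors, Zhang2014.IsKolyvaginPrime (W.conductorNorm ℤ) W K 2 ℓ ∧ 2 ≤ Zhang2014.kolyvaginIndex W 2 ℓ ∧
        FrobEqFrobInfty W K 2 ℓ) ∧
      ¬ ∃ Q : (W.baseChange (ringClassField K ι n)).toAffine.Point, (2 : ℤ) • Q = d.derivedPoint) ↔
    BSDp Wd 2 :=
  ⟨bsdp_twin_of_kFourNeg_witness_of_bsdp hGZ hGZK hL hMi hQ2 W hcm hr0 hρ hT hneg h4 K hIQ hodd h3 hHe hsq1 hsq2 ℓ₀ hℓ₀ hdK h2K Dt hopt hc β ι d₁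
      hy M₀ hdiv hndiv hM₀ Wd hWd hrd hSel hDEF v h2v hNv hmult hBW,
    fun hBd ↦ (GenusSupplyNarrow.KFourCell.LeafCurrency.kFourNeg_conclusion_iff_bsdp hGZ hL hGZK hMi hQ2 W hcm hr0 hρ hT hneg h4 K hIQ hodd
      h3 hHe hsq1 hsq2 ℓ₀ hℓ₀ hdK h2K Dt hopt hc β ι d₁ hy M₀ hdiv hndiv hM₀ Wd hWd hrd hSel hDEF v h2v hNv hmult hBd).mpr hBW⟩

/-- **GIVEN `BSD₂(E)`: K₄⁺-witness at the frame ⟺ `BSD₂(E^(d_K))`** (K₄⁺ cut cell, mod Q2 + PRINT).  (→) §3; (←) gk2-p5's leaf currency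
`PlusDescent.kFourPos_conclusion_iff_bsdp` (`.mpr`).  CONDITIONAL; BSD / K4Pos / U₂ NOT proved. [cite: McCallumLMS1991, §5 Thm. 5.4]
[cite: Miller2011LMS, Def. 1.1] [cite: GrossZagier1986, V §2 (2.2)] [cite: Milne1972ArithmeticAV, §1 Thm. 1] -/
theorem kFourPos_witness_iff_bsdp_twin_of_bsdp
    (hGZ : GrossZagierAllLevels) (hGZK : MultPublishedInputsAtTwo) (hL : EntireLFunctionRat) (hMi : MilneAnyModel)
    (hQ2 : KolyvaginRelationAtTwo)
    (W : WeierstrassCurve ℚ) [W.IsElliptic] [W.IsGloballyMinimal] [NeZero (W.conductorNorm ℤ)] (hcm : ¬ W.HasCM)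
    (hr0 : W.analyticRank = 0) (hρ : ∀ n : ℕ, 0 < n → W.HasSurjectiveModNGaloisRep ((2 : ℤ) ^ n)) (hT : Odd W.tamagawaProduct)
    (hpos : 0 < W.Δ)
    (h4 : Nat.card (W.selmerGroup 2) = 4 ∧ ∃ c ∈ (W.kummerSelmerStructure ((2 : ℕ) : ℤ)).selmerGroup,
      galoisCohomology.localization (W.torsionGaloisModule ((2 : ℕ) : ℤ)) (Sum.inl Rat.infinitePlace) 1 c ≠ 0)
    (K : Type) [Field K] [NumberField K] (hIQ : IsImaginaryQuadratic K) (hodd : Odd (NumberField.discr K))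
    (h3 : NumberField.discr K ≠ -3) (hHe : SatisfiesHeegnerHypothesis (W.conductorNorm ℤ) K)
    (hsq1 : ¬ IsSquare ((NumberField.discr K : ℚ) * -|W.Δ|)) (hsq2 : ¬ IsSquare ((NumberField.discr K : ℚ) * (-(2 * |W.Δ|))))
    (ℓ₀ : ℕ) (hℓ₀ : ℓ₀.Prime) (hdK : NumberField.discr K = -(ℓ₀ : ℤ))
    (h2K : ((Ideal.span {(2 : ℤ)}).primesOver (𝓞 K)).ncard = 2)
    (Dt : ModularParametrizationData W (W.conductorNorm ℤ))
    (hopt : ∀ z ∈ Dt.L.lattice, ∃ w ∈ periodLattice Dt.f, z = (Dt.c : ℂ) * w) (hc : Odd Dt.c)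
    (β : ℤ) (ι : K →+* ℂ) (d₁ : KolyvaginHeegnerData Dt β ι 1) (hy : ¬ IsOfFinAddOrder d₁.derivedPoint) (M₀ : ℕ)
    (hdiv : ∃ Q : (W.baseChange (ringClassField K ι 1)).toAffine.Point, ((2 ^ M₀ : ℕ) : ℤ) • Q = d₁.derivedPoint)
    (hndiv : ¬ ∃ Q : (W.baseChange (ringClassField K ι 1)).toAffine.Point, ((2 ^ (M₀ + 1) : ℕ) : ℤ) • Q = d₁.derivedPoint)
    (hM₀ : 1 ≤ M₀) (Wd : WeierstrassCurve ℚ) [Wd.IsElliptic] [Wd.IsGloballyMinimal]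
    (hWd : ∃ C : VariableChange ℚ, C • W.quadraticTwist (NumberField.discr K : ℚ) = Wd) (hrd : Wd.analyticRank = 1)
    (hSel : Nat.card (Wd.selmerGroup 2) = 2) (hDEF : padicValNat 2 Wd.tamagawaProduct = 0)
    (v : HeightOneSpectrum (𝓞 ℚ)) (h2v : ((2 : ℕ) : 𝓞 ℚ) ∉ v.asIdeal) (hNv : ((W.conductorNorm ℤ : ℕ) : 𝓞 ℚ) ∈ v.asIdeal)
    (hmult : W.HasMultiplicativeReductionAt v)
    (hBW : BSDp W 2) :
    (∃ (n : ℕ) (d : KolyvaginHeegnerData Dt β ι n), Squarefree n ∧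
      (∀ ℓ ∈ n.primeFactors, Zhang2014.IsKolyvaginPrime (W.conductorNorm ℤ) W K 2 ℓ ∧ 2 ≤ Zhang2014.kolyvaginIndex W 2 ℓ ∧
        ∃ (v : HeightOneSpectrum (𝓞 ℚ)) (𝔓 : Ideal (absIntegers (𝓞 ℚ) ℚ)) (h : absoluteGaloisGroup ℚ),
          ((ℓ : ℕ) : 𝓞 ℚ) ∈ v.asIdeal ∧ 𝔓 ∈ v.primesAbove ∧ IsArithFrobAt (𝓞 ℚ) h 𝔓 ∧ ∃ u : W.geomTorsion ((2 : ℕ) : ℤ), h • u ≠ u) ∧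
      ¬ ∃ Q : (W.baseChange (ringClassField K ι n)).toAffine.Point, (2 : ℤ) • Q = d.derivedPoint) ↔
    BSDp Wd 2 :=
  ⟨bsdp_twin_of_kFourPos_witness_of_bsdp hGZ hGZK hL hMi hQ2 W hcm hr0 hρ hT hpos h4 K hIQ hodd h3 hHe hsq1 hsq2 ℓ₀ hℓ₀ hdK h2K Dt hc β ι d₁ hy M₀
      hdiv hndiv hM₀ Wd hWd hrd hSel hDEF v h2v hNv hmult hBW,
    fun hBd ↦ (kFourPos_conclusion_iff_bsdp hGZ hL hGZK hMi hQ2 W hcm hr0 hρ hT hpos v h2v hNv hmult K hIQ hodd h3 hHe hsq1 hsq2 Dt hopt hc β ι d₁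
      hy M₀ hM₀ hdiv hndiv Wd hWd hrd hSel hDEF hBd).mpr hBW⟩

end Summit.BirchSwinnertonDyer.BirchSwinnertonDyer.Theorems.GenusExact.ValuationLedger

end
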